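import Summits.NavierStokesRegularity.NavierStokesRegularity.Theses.TautLoopKelvin
import Literature.Analysis.FluidPDE.NSQuasipotential
import Literature.Analysis.FluidPDE.LerayLocalRegularH1Proofs

/-!
# Disproof of `TautLoopLaw` — findings (crux stmt-NavierStokesRegularity-15249, route TautLoopKelvin)

Refuter work file (cdisprove, cycle 1, 2026-08-17). Everything below elaborates; no `sorry`.
Prose lives in docstrings only. Notation of the crux: for a slice `v = u s`,
`ℓ(v, g) := ⨅ {len γ : γ a C¹ loop, g ≤ |∮_γ v·dl|} ∈ ℝ≥0∞` (here `ell v g`) and the near-taut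
compression rate `Λ(v, g) := ⨅_{ε>0} sSup {k(γ) : γ admissible, len γ ≤ ℓ + ε} ∈ ℝ` (here
`rate v g`), both copied VERBATIM from the crux so that `ell` / `rate` unfold definitionally
into the crux text.

## Verdict of this cycle: no kill; the crux resists cheap refutation, for a structural reason

* The three hypotheses (`IsClassicalNSSolutionOn (Ico 0 T)`, `IsLerayHopfOn T … (u 0) u`,
  `HasRapidSpatialDecay (u 0)`) pin `u` on `[0, T)` to a genuine smooth finite-energy
  Navier–Stokes flow. The only such flow the tree can construct is the rest state, and there the
  law holds (`§1`: `ell 0 g = ⊤` at every slice, `⊤ · e^{-M} ≤ ⊤`). So an unconditional `¬ TautLoopLaw`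
  would need fine loop-space information about a non-explicit NS solution — out of reach, and (see
  "why it resists" below) there is no candidate mechanism either.
* The statement is NOT vacuous (`tautLoopLaw_hypotheses_satisfiable`) and its `ℝ≥0∞` / `ℝ`
  conventions evaluate as the planner intends on the models below (`⊤` on an empty admissible
  class, rate `0` — not junk — on an empty class, `⊤ * ofReal (exp (-M)) = ⊤`).

## Load-bearing analysis landed as theorems (§2, §3)

* `tautLoopLaw_false_without_classical` — with the clause `IsClassicalNSSolutionOn (Ico 0 T) ν 0 u p`
  DELETED the law is FALSE. Witness: the rest state spiked, at the single time `t = 1/2`, by the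
  rigid rotation `rot` on the unit sphere `{‖x‖ = 1}` (a Lebesgue-null set). Every clause of
  `IsLerayHopfOn` reads slices only a.e. (tree `IsLerayHopfOn.congr_ae_slices`), so the spiked
  family is Leray–Hopf from the datum `0`; but the circulation functional reads the velocity on a
  curve — a null set: the unit circle in the `e₀e₁`-plane carries `∮ = 2π` at `t = 1/2` while every
  loop carries `0` at `t = 0`. With `Φ = 0`, `M = 0` (the rate of the empty class is `0`) the law
  would give `⊤ = ℓ(u 0, 1) · 1 ≤ ℓ(u(1/2), 1) ≤ 2π·(length of the circle) < ⊤`. MEANING FOR PROVERS: the loop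
  spectrum is not an a.e.-class quantity; any weak/mild-class step (weak–strong uniqueness,
  energy methods) must be brought back to the continuous representative that only the classical
  clause supplies. In particular the `⊤`-clause of the law ("no admissible loop at `t₁` ⇒ none at
  `t₂`", forced by `⊤ * ofReal (exp (-M)) = ⊤`) is exactly FORWARD UNIQUENESS FROM REST inside the
  class: `ω(t₁) ≡ 0` + finite energy ⇒ `u(t₁) ≡ 0` ⇒ `u ≡ 0` on `[t₁, T)`. A proof of the crux
  must contain that uniqueness statement (energy equality for classical + Leray–Hopf slices from
  `s = t₁`, i.e. the a.e.-`s` energy inequality upgraded to every `s` by continuity of the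
  classical representative).
* `tautLoopLaw_false_upto_terminal_time` — the side condition `t₂ < T` is sharp for the same
  representative reason: with `t₂ ≤ T` allowed, the terminal slice `u T` is pinned only a.e. (weak
  `L²` limit), and the rest state on `[0, 1)` spiked on the unit sphere AT `t = T = 1` is classical on
  `Ico 0 1`, Leray–Hopf on `[0, 1]`, and violates the law from `t₁ = 0` to `t₂ = 1`.
* Dropping ONLY the Leray–Hopf clause (keeping classical + decaying datum) should also break the
  `⊤`-clause, through NON-UNIQUENESS of classical solutions without growth control: the shear
  flows `u = (0, 0, w(t, x₁, x₂))`, `p = 0`, with `w` a Tychonoff (non-unique, super-Gaussian growth)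
  solution of the planar heat equation vanishing at `t = 0`, are classical NS solutions from the
  datum `0` with `ω(t₂) ≢ 0`, hence `ℓ(g, 0) = ⊤ > ℓ(g, t₂)`. NOT formalised (no Tychonoff
  construction in the tree); recorded so that provers see that the finite-energy class is used
  twice: for uniqueness from rest and (below) for compactness of near-taut families.

## Why the law resists (analysis, no Lean) — read before attacking it again

1. FORMAL SOUNDNESS OF THE MECHANISM. For every explicit family tried on paper the law is an
   honest envelope (Danskin) inequality: shear flows `u = (f(y, z, t), 0, 0)` (near-taut loops are
   long rounded rectangles, `ℓ(g,t) = inf_{y₁,y₂} [2g / (f(y₁) − f(y₂)) + 2|y₁ − y₂|]`; at an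
   optimal pair the second-order condition in the TRANSLATION direction gives
   `f''(y₁) − f''(y₂) ≤ 0`, which is exactly `∮_{C*} Δu·dl ≤ 0`, so `∂ₜℓ ≥ 0 = −Λℓ` — my attempted
   violation `f''(y₁) > 0 > f''(y₂)` is never an optimum); Lamb–Oseen / Burgers / Lundgren as in the
   route file (equality / stationarity / saturation); the `g → ∞` regime, where by MULTIPLE COVERS
   (an `n`-fold cover of a loop is a `C¹` loop with `n` times the circulation and the length)
   `ℓ(g, t) < ⊤` for EVERY `g` as soon as `ω(t) ≢ 0`, `ℓ(g,t) ≈ g / V(t)` with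
   `V(t) := sup_C |∮_C u| / len C ≤ ‖u(t)‖_∞`, and the law becomes `D⁺ log V ≤ k` at the
   max-circulation-density loops — again Danskin plus the drain sign. No counterexample mechanism
   survives at the level of formal first/second variations.
2. THE PLANNER'S FEARED GAP IS PARTLY SELF-HEALING. Left-discontinuity of `γ ↦ ℓ(γ, t₁)` at the
   level `g` (short loops with `|∮| ↑ g` but every loop with `|∮| ≥ g` much longer) can only happen
   at an ABNORMAL local maximiser `C₀` of `|∮|` (first variation `ω × τ ≡ 0` along `C₀`: a closed
   vortex polygon with corners at zeros of `ω`, so that `C₀` is Lipschitz but every nearby `C¹` loop is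
   sub-level). But `C₀` is then also a local max over translates, so `sign(∮) ∮_{C₀} Δu·dl ≤ 0`
   and `(u × ω)·τ = 0` on `C₀`: to first order in time every loop near `C₀`, material or not, LOSES
   circulation, so `ℓ(g, t₁ + h)` does not drop to `len C₀`. The residual danger is the doubly
   degenerate case (`∮_{C₀} Δu·dl = 0` at an abnormal maximiser), decided by `O(h²)` terms — no
   cheap witness, and certifying `ℓ(g, 0) > len C₀` in Lean means controlling ALL `C¹` loops of `ℝ³`.
   Suggested robust restatement if a prover gets stuck exactly here: put the LEFT LIMIT
   `⨆_{g' < g} ℓ(u t₁, g')` on the small side of the inequality (it is what the pull-back Grönwall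
   actually produces: levels degrade by `o(1)` along the partition).
3. HIDDEN REGULARITY DEBTS (junk guards the prover must discharge, not refutations):
   `sSup` / `⨅` over `ℝ` return `0` on unbounded sets. `|k(γ)| ≤ sup_{γ} ‖∇u(s)‖`, so the
   near-taut set `K_ε(s)` is bounded iff near-taut loops see bounded gradient; `IsClassicalNSSolutionOn`
   gives smoothness but NOT `‖∇u(s)‖_∞ < ∞` on `ℝ³` — that comes from the finite-energy class
   (the classical Leray–Hopf solution is the mild one, bounded with all derivatives on compact
   sub-intervals of `(0, T)`), i.e. again from weak–strong uniqueness. If `K_ε(s)` were unbounded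
   above, the formal `Λ` would silently be `0` and `Φ = 0` would be accepted as a majorant.
4. NEGATIVE RESULTS IN PRINT: none found against a loop-space one-sided law (the nearest,
   Constantin–Iyer stochastic Kelvin doi:10.1002/cpa.20192 and Córdoba–Fefferman material-tube
   non-collapse doi:10.1007/s002200100502, are identities / lower bounds of a different object);
   `ledger negatives --problem NavierStokesRegularity` (AdiabaticEddy corrector, SymmetryModuliCount,
   Blowup X5b) untouched by this crux.

## -- Line `Sketch-ideas-r1k1` (PICKED 2026-08-17; six stubs) — cheap attacks on each stub, all SURVIVE

* `stub_tautLoopDiniSaks` (pure): TRUE on paper by backward real induction on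
  `G = {s : f s ≤ f b · exp(∫_s^b Ψ + η(b−s) + η)}` with an lsc Vitali–Carathéodory majorant
  `Ψ > Φ⁺` (strict, pointwise — needed so that lsc of `Ψ` at `s` gives `∫_{s-h}^s Ψ ≥ hΛ(s)`);
  closedness under decreasing limits uses `liminf_{𝓝[>] s} f ≤ liminf_n f(s_n)`; the uncontrolled
  `Λ b` is absorbed by the additive `η`. Edge cases checked: `a = b` (`e^{-M} ≤ 1`), `f b = 0`
  (step forces `f = 0` leftwards, lsc closes), `f a = ⊤` with `f b < ⊤` (excluded by the hypotheses, e.g.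
  `f = 1/(s−a)` needs `Λ = 1/(s−a)`, not integrable), downward jumps from the left (killed by the step),
  from the right (killed by right-lsc), Cantor-type singular decrease (its left Dini derivates are
  infinite on an uncountable set, so no real-valued `Λ` gives the step). No counterexample.
* `stub_tautLoopRightLscTransfer` (pure): TRUE on paper: for `c < ℓ(u t, g)` and `s ↓ t` with
  `ℓ(u s, g) < c`, a loop of length `< c` admissible at `s` is admissible at `t` at level `g − κ(s)c`;
  nonempty class ⇒ contradiction with level-left-continuity; EMPTY class at `t` ⇒ (k-fold covers) all
  circulations of `u t` vanish ⇒ `g ≤ κ(s) c → 0`, contradiction; hence `liminf ≥` every `c`.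
* `stub_tautLoopLevelLeftContinuity` (static): my feared counterexample (an ABNORMAL cornered local
  maximiser of `|∮|`, a vortex polygon with corners at zeros of `ω`) does NOT bite: `IsC1Loop` is
  `ContDiff 1 ∧ Periodic` with NO immersion condition, so polygons (stop at corners), there-and-back
  tethers and many-windings lassos are admissible. The lasso repays a level deficit `δ` at cost
  `2d + 2δ/(d · w_d)`, `w_d = max |ω|` within distance `d` (`w_d > 0` for all `d` unless `ω ≡ 0` near the
  limit loop, where homotopy invariance gives no deficit) — a double limit `δ → 0` then `d → 0`, no
  vanishing-order hypothesis needed at a FIXED field. Survives. (For Lean: the limit loop is only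
  Lipschitz; the stub rightly avoids asserting attainment.)
* `stub_tautLoopSlabRegularity`, `stub_tautLoopViscousKelvin`: classical facts (mild = classical LH
  solution; Majda–Bertozzi (1.61) with `X` any pointwise solution family of `∂ₜX = u(t,X)`, mixed
  partials fine since `X` is jointly smooth and `γ` enters only through `γ, γ'`). Checked: the stub's
  `Laplacian.laplacian (u t)` is definitionally (`rfl`) the `Δ (u t)` of `IsClassicalNSSolutionOn.momentum`.
* `stub_tautLoopExactLevelStep` (new mathematics): no cheap kill. WARNING (not a refutation): the step
  is demanded at EVERY `t ∈ (0,T)` for EVERY `η > 0` with the EXACT level; at a time where the taut loop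
  has degenerate drain (`∮_{C*} Δu·dl = 0`) the deterministic pull-back leaves a deficit `O(h²)` whose
  lasso repair costs `4h√(c/w)` — O(h) with a constant NOT shrinking with `η`; only the random-walk
  Kelvin selection (exact expectation identity `∮_C u_t = 𝔼 ∮_{A_ω C} u_{t-h}`, Gaussian tail
  `e^{-cη²/h}` for the length event since the noise is spatially constant, deficit `O(e^{-c/h})`,
  analyticity floor `w_d ≳ d^N`) makes the repair `o(h)`. So the deterministic `translation-max-drain`
  fallback alone does NOT give the stub as stated (translation-max yields drain only up to `O(√h)`,
  deficit `O(h^{3/2})`, lasso `O(h^{3/4}) ≫ h`); the stochastic card is load-bearing. Junk guards the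
  lead must discharge inside the stub: `BddAbove` of the near-taut set and `BddBelow` of
  `ε ↦ sSup K_ε` (else `Λ_g(t)` is silently `0`), both from `‖∇u(t)‖_∞ < ∞` (slab regularity).
* Joint sufficiency: `TautLoopLaw_of` is kernel-checked in the skeleton (rc 0, sorries = stubs only).

## Index
* §0 frame vectors, the rotation field, the sphere-spiked rest state (`spikeVel τ`).
* §1 `ell`, `rate` (verbatim abbreviations); rest state: `ell_zero`, `rate_zero_nonpos`,
  non-vacuity `tautLoopLaw_hypotheses_satisfiable`, `law_holds_at_rest`; mutation `0 < g` cosmetic: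
  `ell_of_nonpos`, `law_trivial_of_nonpos_level`. Other mutations (paper): `0 < ν` not used by the
  mechanism (Euler case formally identical, Kelvin exact); `HasRapidSpatialDecay (u 0)` is used by the
  route's `closes` (sup bound of the datum), not visibly by the law; `0 ≤ t₁`, `t₂ < T` guard junk
  slices (§3); `0 ≤ M` guards `ofReal M`.
* §2 `TautLoopLawWithoutClassical`, `tautLoopLaw_false_without_classical`.
* §3 `TautLoopLawUptoT` (`t₂ ≤ T`), `tautLoopLaw_false_upto_terminal_time`.
* §4 line stub `stub_tautLoopDiniSaks` is sharp: `diniSaks_false_off_one_point` (no exceptional time for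
  the left-Dini step), `diniSaks_false_without_lsc_at_left_end` (right-lsc AT `t₁` needed).
* §5 line stub `stub_tautLoopRightLscTransfer`: `rightLscTransfer_false_without_supnorm` (the sup-norm
  right-continuity clause — clause (ii) of `stub_tautLoopSlabRegularity` — cannot be dropped).
* -- Targets: none broken (payload `stuck_stubs = []`; line stubs attacked on paper, see above).
* Landing: §0–§3 proposed as `Theorems/TautLoopLaw/Negative/ClassicalClauseLoadBearing.lean`
  (`--supports stmt-NavierStokesRegularity-15249`).
-/

noncomputable section

open MeasureTheory Set Function Filter Metric Real
open scoped Topology RealInnerProductSpace ENNReal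
open Literature.Analysis.FluidPDE

namespace Summit.NavierStokesRegularity.NavierStokesRegularity.Cruxes.TautLoopLaw.Disproof

set_option linter.dupNamespace false

/-- Local notation for physical space `ℝ³ = EuclideanSpace ℝ (Fin 3)`. -/
local notation "ℝ³" => EuclideanSpace ℝ (Fin 3)

/-! ## §0 Frame, rotation field, the sphere-spiked rest state -/

/-- First coordinate vector. -/
def e0 : ℝ³ := EuclideanSpace.single 0 1

/-- Second coordinate vector. -/
def e1 : ℝ³ := EuclideanSpace.single 1 1

/-- The frame table: `e0`, `e1` are orthonormal (all six entries at once). -/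
theorem frame_table :
    ‖e0‖ = 1 ∧ ‖e1‖ = 1 ∧ ⟪e0, e1⟫ = 0 ∧ ⟪e1, e0⟫ = 0 ∧ ⟪e0, e0⟫ = 1 ∧ ⟪e1, e1⟫ = 1 := by
  have h0 : ‖e0‖ = 1 := by simp [e0]
  have h1 : ‖e1‖ = 1 := by simp [e1]
  have h01 : ⟪e0, e1⟫ = 0 := by simp [e0, e1, EuclideanSpace.inner_single_left]
  refine ⟨h0, h1, h01, by rw [real_inner_comm]; exact h01, ?_, ?_⟩
  · rw [real_inner_self_eq_norm_sq, h0]; norm_num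
  · rw [real_inner_self_eq_norm_sq, h1]; norm_num

/-- Inner products of frame combinations. -/
theorem inner_frame (a b c d : ℝ) :
    ⟪a • e0 + b • e1, c • e0 + d • e1⟫ = a * c + b * d := by
  obtain ⟨-, -, h01, h10, h00, h11⟩ := frame_table
  simp only [inner_add_left, inner_add_right, real_inner_smul_left, real_inner_smul_right,
    h00, h01, h10, h11]
  ring

/-- First frame coefficient. -/
theorem inner_frame_e0 (a b : ℝ) : ⟪a • e0 + b • e1, e0⟫ = a := by
  simpa using inner_frame a b 1 0

/-- Second frame coefficient. -/
theorem inner_frame_e1 (a b : ℝ) : ⟪a • e0 + b • e1, e1⟫ = b := by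
  simpa using inner_frame a b 0 1

/-- Points of the unit circle of the `e0e1`-plane have norm one. -/
theorem norm_frame_cos_sin (θ : ℝ) : ‖cos θ • e0 + sin θ • e1‖ = 1 := by
  have h : ‖cos θ • e0 + sin θ • e1‖ ^ 2 = 1 := by
    rw [← real_inner_self_eq_norm_sq, inner_frame]
    nlinarith [cos_sq_add_sin_sq θ]
  have h0 : 0 ≤ ‖cos θ • e0 + sin θ • e1‖ := norm_nonneg _
  nlinarith [h, h0]

/-- The rigid rotation about the `e2`-axis, written frame-free: `rot x = -⟪x,e1⟫ e0 + ⟪x,e0⟫ e1`. -/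
def rot (x : ℝ³) : ℝ³ := (-⟪x, e1⟫) • e0 + ⟪x, e0⟫ • e1

/-- On the unit circle of the `e0e1`-plane the rotation field is the unit tangent. -/
theorem rot_frame (θ : ℝ) : rot (cos θ • e0 + sin θ • e1) = (-sin θ) • e0 + cos θ • e1 := by
  simp only [rot, inner_frame_e0, inner_frame_e1]

/-- **The sphere-spiked rest state** with spike time `τ`: `u(t, x) = rot x` if `t = τ` and
`‖x‖ = 1`, and `0` otherwise — an a.e.-modification (unit sphere, one instant) of the rest state. -/
def spikeVel (τ : ℝ) : ℝ → ℝ³ → ℝ³ := fun t x => if t = τ ∧ ‖x‖ = 1 then rot x else 0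

/-- Away from the spike time the spiked rest state is the rest state. -/
theorem spikeVel_of_ne {τ t : ℝ} (ht : t ≠ τ) : spikeVel τ t = 0 := by
  funext x
  simp [spikeVel, ht]

/-- At the spike time, on the unit sphere, the spiked rest state is the rotation field. -/
theorem spikeVel_at_of_norm {τ : ℝ} {x : ℝ³} (hx : ‖x‖ = 1) : spikeVel τ τ x = rot x := by
  simp [spikeVel, hx]

/-- Off the unit sphere the spiked rest state vanishes at all times. -/
theorem spikeVel_of_norm_ne {τ t : ℝ} {x : ℝ³} (hx : ‖x‖ ≠ 1) : spikeVel τ t x = 0 := by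
  simp [spikeVel, hx]

/-- Every slice of the spiked rest state vanishes off the unit sphere, hence a.e. -/
theorem spikeVel_slice_ae_eq (τ t : ℝ) : spikeVel τ t =ᵐ[volume] (0 : ℝ³ → ℝ³) := by
  have hsub : {x : ℝ³ | ¬ spikeVel τ t x = (0 : ℝ³ → ℝ³) x} ⊆ sphere (0 : ℝ³) 1 := by
    intro x hx
    rw [mem_sphere_zero_iff_norm]
    by_contra h1
    exact hx (by rw [spikeVel_of_norm_ne h1]; rfl)
  rw [Filter.EventuallyEq, ae_iff]
  exact measure_mono_null hsub (Measure.addHaar_sphere volume 0 1)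

/-- The spiked rest state vanishes a.e. in space–time (it is supported in `{τ} × ℝ³`). -/
theorem uncurry_spikeVel_ae_eq (τ : ℝ) : uncurry (spikeVel τ) =ᵐ[volume] (0 : ℝ × ℝ³ → ℝ³) := by
  have hsub : {z : ℝ × ℝ³ | ¬ uncurry (spikeVel τ) z = (0 : ℝ × ℝ³ → ℝ³) z} ⊆ {τ} ×ˢ univ := by
    rintro ⟨t, x⟩ hx
    refine mk_mem_prod ?_ (mem_univ _)
    by_contra h0
    exact hx (by simp [uncurry, spikeVel_of_ne h0])
  rw [Filter.EventuallyEq, ae_iff]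
  refine measure_mono_null hsub ?_
  rw [Measure.volume_eq_prod, Measure.prod_prod, measure_singleton, zero_mul]

/-- **The spiked rest state is Leray–Hopf from rest** on `[0, T)` for every `T > 0`, every
viscosity and every spike time `τ ≠ 0`: all clauses of `IsLerayHopfOn` are a.e.-stable in the slices
(tree `isLerayHopfOn_zero`, `IsLerayHopfOn.congr_ae_slices`). -/
theorem isLerayHopfOn_spikeVel {τ T : ℝ} (hτ : τ ≠ 0) (hT : 0 < T) (ν : ℝ) :
    IsLerayHopfOn T ν 0 (spikeVel τ 0) (spikeVel τ) := by
  rw [spikeVel_of_ne hτ.symm]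
  refine (isLerayHopfOn_zero T ν).congr_ae_slices hT ?_ fun t _ => spikeVel_slice_ae_eq τ t
  exact (aestronglyMeasurable_const.congr (uncurry_spikeVel_ae_eq τ).symm).restrict

/-- The datum of the spiked rest state (spike time `τ ≠ 0`) is the rapidly decaying `0`
(namesakes of the decay of `0` live in other Negative folders; not imported, four lines). -/
theorem hasRapidSpatialDecay_spikeVel_zero {τ : ℝ} (hτ : τ ≠ 0) :
    HasRapidSpatialDecay (spikeVel τ 0) := by
  rw [spikeVel_of_ne hτ.symm]
  refine fun n K => ⟨0, fun x => ?_⟩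
  have : iteratedFDeriv ℝ n (0 : ℝ³ → ℝ³) x = 0 := by
    rw [Pi.zero_def, iteratedFDeriv_fun_zero]; rfl
  rw [this, norm_zero, mul_zero]

/-- **A classical solution that is pointwise `0` on the time set is interchangeable with the rest
state**: if `u t = 0` for all `t ∈ S` then `(u, 0)` is a classical solution on `S` (joint
smoothness is a `ContDiffOn` statement on `S ×ˢ univ`, the time derivative is `derivWithin _ S`). -/
theorem isClassicalNSSolutionOn_of_eqOn_zero {S : Set ℝ} {u : ℝ → ℝ³ → ℝ³}
    (hu : ∀ t ∈ S, u t = 0) (ν : ℝ) : IsClassicalNSSolutionOn S ν 0 u 0 where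
  smooth_velocity := by
    unfold IsSmoothSpaceTimeOn
    refine (contDiffOn_const (c := (0 : ℝ³))).congr ?_
    rintro ⟨t, x⟩ htx
    simp [uncurry, hu t htx.1]
  smooth_pressure := (isClassicalNSSolutionOn_zero S ν (E := ℝ³)).smooth_pressure
  momentum t ht x := by
    have h1 : timeDerivWithin S u t x = 0 := by
      rw [timeDerivWithin_apply]
      have : derivWithin (fun s => u s x) S t = derivWithin (fun _ : ℝ => (0 : ℝ³)) S t :=
        derivWithin_congr (fun s hs => by simp [hu s hs]) (by simp [hu t ht])
      rw [this, derivWithin_fun_const, Pi.zero_apply]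
    have h0 := (isClassicalNSSolutionOn_zero S ν (E := ℝ³)).momentum t ht x
    have h2 : timeDerivWithin S (0 : ℝ → ℝ³ → ℝ³) t x = 0 := by simp [timeDerivWithin]
    rw [h2] at h0
    rw [h1, hu t ht]
    exact h0
  divFree t ht := by
    rw [hu t ht]
    exact (isClassicalNSSolutionOn_zero S ν (E := ℝ³)).divFree t ht

/-- The spiked rest state with spike time `τ ∉ S` is classical on `S` (with pressure `0`). -/
theorem isClassicalNSSolutionOn_spikeVel {S : Set ℝ} {τ : ℝ} (hτ : τ ∉ S) (ν : ℝ) :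
    IsClassicalNSSolutionOn S ν 0 (spikeVel τ) 0 :=
  isClassicalNSSolutionOn_of_eqOn_zero (fun _ ht => spikeVel_of_ne (ne_of_mem_of_not_mem ht hτ)) ν

/-- The unit circle of the `e0e1`-plane as a `C¹` loop. -/
def unitCircle : ℝ → ℝ³ := circleLoop (0 : ℝ³) 1 e0 e1

/-- The unit circle is a closed `C¹` loop. -/
theorem isC1Loop_unitCircle : IsC1Loop unitCircle := isC1Loop_circleLoop _ _ _ _

/-- **The spike carries circulation `2π` on the unit circle**: at the spike time the velocity on the
circle is the unit tangent. -/
theorem circulation_spikeVel_at (τ : ℝ) : circulation (spikeVel τ τ) unitCircle = 2 * π := by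
  rw [unitCircle, circulation_circleLoop]
  have hpt : ∀ θ : ℝ, ⟪spikeVel τ τ ((0 : ℝ³) + ((1 : ℝ) * cos θ) • e0 + ((1 : ℝ) * sin θ) • e1),
      (-((1 : ℝ) * sin θ)) • e0 + ((1 : ℝ) * cos θ) • e1⟫ = (1 : ℝ) := by
    intro θ
    simp only [one_mul, zero_add]
    rw [spikeVel_at_of_norm (norm_frame_cos_sin θ), rot_frame, inner_frame]
    nlinarith [sin_sq_add_cos_sq θ]
  simp_rw [hpt]
  rw [intervalIntegral.integral_const]
  simp

/-- The unit circle is admissible at level `1` for the spike slice (`2π ≥ 1`). -/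
theorem one_le_abs_circulation_spikeVel_at (τ : ℝ) :
    (1 : ℝ) ≤ |circulation (spikeVel τ τ) unitCircle| := by
  rw [circulation_spikeVel_at, abs_of_pos (by positivity)]
  linarith [pi_gt_three]

/-! ## §1 The spectrum `ell` and the rate `rate` (verbatim from the crux); the rest state -/

/-- The circulation–length spectrum of a slice `v` at level `g`, VERBATIM the crux's inlined `⨅`. -/
def ell (v : ℝ³ → ℝ³) (g : ℝ) : ℝ≥0∞ :=
  ⨅ (γ' : ℝ → EuclideanSpace ℝ (Fin 3)) (_ : Literature.Analysis.FluidPDE.IsC1Loop γ' ∧ g ≤ |Literature.Analysis.FluidPDE.circulation v γ'|), ENNReal.ofReal (∫ σ in (0:ℝ)..1, ‖deriv γ' σ‖)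

/-- The near-taut compression rate of a slice `v` at level `g`, VERBATIM the crux's inlined
`⨅ ε, sSup {…}` (an `ℝ`-valued `⨅` of `ℝ`-valued `sSup`s: `0` on empty / unbounded sets). -/
def rate (v : ℝ³ → ℝ³) (g : ℝ) : ℝ :=
  ⨅ ε : {ε : ℝ // 0 < ε}, sSup {k : ℝ | ∃ γ : ℝ → EuclideanSpace ℝ (Fin 3), Literature.Analysis.FluidPDE.IsC1Loop γ ∧ g ≤ |Literature.Analysis.FluidPDE.circulation v γ| ∧ ENNReal.ofReal (∫ σ in (0:ℝ)..1, ‖deriv γ σ‖) ≤ (⨅ (γ' : ℝ → EuclideanSpace ℝ (Fin 3)) (_ : Literature.Analysis.FluidPDE.IsC1Loop γ' ∧ g ≤ |Literature.Analysis.FluidPDE.circulation v γ'|), ENNReal.ofReal (∫ σ in (0:ℝ)..1, ‖deriv γ' σ‖)) + ENNReal.ofReal (ε : ℝ) ∧ k = ((∫ σ in (0:ℝ)..1, -(inner ℝ (deriv γ σ) (fderiv ℝ v (γ σ) (deriv γ σ))) / ‖deriv γ σ‖) / (∫ σ in (0:ℝ)..1, ‖deriv γ σ‖))}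

/-- Sanity: the crux IS the statement "for classical Leray–Hopf solutions from decaying data,
`rate`-majorants control `ell`" — the abbreviations unfold definitionally into the crux. -/
theorem tautLoopLaw_iff :
    Summit.NavierStokesRegularity.NavierStokesRegularity.Theses.TautLoopKelvin.TautLoopLaw ↔
    ∀ (ν T : ℝ), 0 < ν → 0 < T → ∀ (u : ℝ → ℝ³ → ℝ³) (p : ℝ → ℝ³ → ℝ),
      IsClassicalNSSolutionOn (Set.Ico 0 T) ν 0 u p → IsLerayHopfOn T ν 0 (u 0) u →
      HasRapidSpatialDecay (u 0) → ∀ g : ℝ, 0 < g → ∀ t₁ t₂ : ℝ, 0 ≤ t₁ → t₁ ≤ t₂ → t₂ < T →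
      ∀ (Φ : ℝ → ℝ) (M : ℝ), Measurable Φ → 0 ≤ M → (∀ s ∈ Set.Ioo t₁ t₂, rate (u s) g ≤ Φ s) →
      (∫⁻ s in Set.Ioo t₁ t₂, ENNReal.ofReal (Φ s)) ≤ ENNReal.ofReal M →
      ell (u t₁) g * ENNReal.ofReal (Real.exp (-M)) ≤ ell (u t₂) g :=
  Iff.rfl

/-- **At an irrotational (here: zero) slice the admissible class is empty and `ell = ⊤`.** -/
theorem ell_zero {g : ℝ} (hg : 0 < g) : ell (0 : ℝ³ → ℝ³) g = ⊤ := by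
  unfold ell
  refine iInf_eq_top.2 fun γ => iInf_eq_top.2 fun h => ?_
  have h2 := h.2
  rw [circulation_zero_left, abs_zero] at h2
  exact absurd h2 (not_le.2 hg)

/-- **At a zero slice the near-taut rate is `≤ 0` (in fact `0`): the `sSup` of the empty set is `0`,
not junk-infinite — so `Φ = 0`, `M = 0` is an admissible majorant across a resting interval.** -/
theorem rate_zero_nonpos {g : ℝ} (hg : 0 < g) : rate (0 : ℝ³ → ℝ³) g ≤ 0 := by
  unfold rate
  refine Real.iInf_nonpos' ⟨⟨1, one_pos⟩, Real.sSup_nonpos ?_⟩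
  rintro k ⟨γ, -, hk, -, -⟩
  rw [circulation_zero_left, abs_zero] at hk
  exact absurd hk (not_le.2 hg)

/-- **Non-vacuity**: the hypotheses of the crux are met (rest state, `ν = T = 1`). -/
theorem tautLoopLaw_hypotheses_satisfiable :
    ∃ (ν T : ℝ) (u : ℝ → ℝ³ → ℝ³) (p : ℝ → ℝ³ → ℝ), 0 < ν ∧ 0 < T ∧
      IsClassicalNSSolutionOn (Ico 0 T) ν 0 u p ∧ IsLerayHopfOn T ν 0 (u 0) u ∧
      HasRapidSpatialDecay (u 0) := by
  have hdec : HasRapidSpatialDecay ((0 : ℝ → ℝ³ → ℝ³) 0) := by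
    have h := hasRapidSpatialDecay_spikeVel_zero (τ := 2) two_ne_zero
    rwa [spikeVel_of_ne (by norm_num : (0 : ℝ) ≠ 2)] at h
  exact ⟨1, 1, 0, 0, one_pos, one_pos, isClassicalNSSolutionOn_zero _ 1, isLerayHopfOn_zero 1 1, hdec⟩

/-- … and at the rest state the conclusion of the law holds for all levels, times and `M`
(`⊤ * ofReal (exp (-M)) ≤ ⊤`): the only constructible model does not refute the crux. -/
theorem law_holds_at_rest {g : ℝ} (hg : 0 < g) (t₁ t₂ M : ℝ) :
    ell ((0 : ℝ → ℝ³ → ℝ³) t₁) g * ENNReal.ofReal (Real.exp (-M)) ≤ ell ((0 : ℝ → ℝ³ → ℝ³) t₂) g := by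
  have h : ell ((0 : ℝ → ℝ³ → ℝ³) t₂) g = ⊤ := ell_zero hg
  rw [h]
  exact le_top

/-- **Mutation: the guard `0 < g` is cosmetic.** At a level `g ≤ 0` the constant loop is
admissible (circulation `0 ≥ g`, length `0`), so `ell v g = 0` for EVERY field … -/
theorem ell_of_nonpos (v : ℝ³ → ℝ³) {g : ℝ} (hg : g ≤ 0) : ell v g = 0 := by
  unfold ell
  have hadm : IsC1Loop (fun _ : ℝ => (0 : ℝ³)) ∧ g ≤ |circulation v (fun _ : ℝ => (0 : ℝ³))| :=
    ⟨⟨contDiff_const, fun _ => rfl⟩, hg.trans (abs_nonneg _)⟩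
  refine le_antisymm ((iInf₂_le (fun _ : ℝ => (0 : ℝ³)) hadm).trans (le_of_eq ?_)) bot_le
  have : deriv (fun _ : ℝ => (0 : ℝ³)) = fun _ => 0 := by
    funext s; exact deriv_const s _
  simp [this]

/-- … hence the law's conclusion at levels `g ≤ 0` holds for every family `u` whatsoever
(`0 * c ≤ _`): a proof may assume `0 < g` for free, and dropping the guard changes nothing. -/
theorem law_trivial_of_nonpos_level (u : ℝ → ℝ³ → ℝ³) {g : ℝ} (hg : g ≤ 0) (t₁ t₂ M : ℝ) :
    ell (u t₁) g * ENNReal.ofReal (Real.exp (-M)) ≤ ell (u t₂) g := by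
  rw [ell_of_nonpos (u t₁) hg, zero_mul]
  exact bot_le

/-- The spectrum of the spike slice at level `1` is finite (the unit circle is admissible). -/
theorem ell_spikeVel_at_lt_top (τ : ℝ) : ell (spikeVel τ τ) 1 < ⊤ := by
  unfold ell
  exact (iInf₂_le unitCircle ⟨isC1Loop_unitCircle, one_le_abs_circulation_spikeVel_at τ⟩).trans_lt
    ENNReal.ofReal_lt_top

/-- The spectrum of the spiked family away from the spike time is `⊤`. -/
theorem ell_spikeVel_of_ne {τ t : ℝ} (ht : t ≠ τ) {g : ℝ} (hg : 0 < g) : ell (spikeVel τ t) g = ⊤ := by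
  rw [spikeVel_of_ne ht]; exact ell_zero hg

/-- The rate of the spiked family away from the spike time is `≤ 0`. -/
theorem rate_spikeVel_of_ne {τ t : ℝ} (ht : t ≠ τ) {g : ℝ} (hg : 0 < g) :
    rate (spikeVel τ t) g ≤ 0 := by
  rw [spikeVel_of_ne ht]; exact rate_zero_nonpos hg

/-! ## §2 The classical clause is load-bearing (through the representative) -/

/-- The crux with the clause `IsClassicalNSSolutionOn (Set.Ico 0 T) ν 0 u p` DELETED (the pressure
`p` then disappears); everything else verbatim. -/
def TautLoopLawWithoutClassical : Prop :=
  ∀ (ν T : ℝ), 0 < ν → 0 < T → ∀ (u : ℝ → EuclideanSpace ℝ (Fin 3) → EuclideanSpace ℝ (Fin 3)), Literature.Analysis.FluidPDE.IsLerayHopfOn T ν 0 (u 0) u → Literature.Analysis.FluidPDE.HasRapidSpatialDecay (u 0) → ∀ g : ℝ, 0 < g → ∀ t₁ t₂ : ℝ, 0 ≤ t₁ → t₁ ≤ t₂ → t₂ < T → ∀ (Φ : ℝ → ℝ) (M : ℝ), Measurable Φ → 0 ≤ M → (∀ s ∈ Set.Ioo t₁ t₂, (⨅ ε : {ε : ℝ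 // 0 < ε}, sSup {k : ℝ | ∃ γ : ℝ → EuclideanSpace ℝ (Fin 3), Literature.Analysis.FluidPDE.IsC1Loop γ ∧ g ≤ |Literature.Analysis.FluidPDE.circulation (u s) γ| ∧ ENNReal.ofReal (∫ σ in (0:ℝ)..1, ‖deriv γ σ‖) ≤ (⨅ (γ' : ℝ → EuclideanSpace ℝ (Fin 3)) (_ : Literature.Analysis.FluidPDE.IsC1Loop γ' ∧ g ≤ |Literature.Analysis.FluidPDE.circulation (u s) γ'|), ENNReal.ofReal (∫ σ in (0:ℝ)..1, ‖deriv γ' σ‖)) + ENNReal.ofReal (ε : ℝ) ∧ k = ((∫ σ in (0:ℝ)..1, -(inner ℝ (deriv γ σ) (fderiv ℝ (u s) (γ σ) (deriv γ σ))) / ‖deriv γ σ‖) / (∫ σ in (0:ℝ)..1, ‖deriv γ σ‖))}) ≤ Φ s) → (∫⁻ s in Set.Ioo t₁ t₂, ENNReal.ofReal (Φ s)) ≤ ENNReal.ofReal M → (⨅ (γ' : ℝ → EuclideanSpace ℝ (Fin 3)) (_ : Literature.Analysis.FluidPDE.IsC1Loop γ' ∧ g ≤ |Literature.Analysis.FluidPDE.circulation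 (u t₁) γ'|), ENNReal.ofReal (∫ σ in (0:ℝ)..1, ‖deriv γ' σ‖)) * ENNReal.ofReal (Real.exp (-M)) ≤ (⨅ (γ' : ℝ → EuclideanSpace ℝ (Fin 3)) (_ : Literature.Analysis.FluidPDE.IsC1Loop γ' ∧ g ≤ |Literature.Analysis.FluidPDE.circulation (u t₂) γ'|), ENNReal.ofReal (∫ σ in (0:ℝ)..1, ‖deriv γ' σ‖))

/-- **`TautLoopLaw` is FALSE without its classical clause.** Witness: the rest state spiked by the
rigid rotation on the unit sphere at `t = 1/2` (`ν = T = 1`, `g = 1`, `t₁ = 0`, `t₂ = 1/2`, `Φ = 0`,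
`M = 0`): Leray–Hopf from the decaying datum `0` (a.e.-invisible spike), rate `≤ 0` on `(0, 1/2)`
(resting slices), but `ℓ(u 0, 1) = ⊤` while the unit circle carries `|∮ u(1/2)·dl| = 2π ≥ 1`, so
`ℓ(u(1/2), 1) < ⊤` and `⊤ * 1 ≤ ℓ(u(1/2), 1)` fails. Any proof of the crux must use the continuous
representative fixed by `IsClassicalNSSolutionOn`; its `⊤`-clause is forward uniqueness from rest. -/
theorem tautLoopLaw_false_without_classical : ¬ TautLoopLawWithoutClassical := by
  intro h
  have hτ : (1 / 2 : ℝ) ≠ 0 := by norm_num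
  have key := h 1 1 one_pos one_pos (spikeVel (1 / 2)) (isLerayHopfOn_spikeVel hτ one_pos 1)
    (hasRapidSpatialDecay_spikeVel_zero hτ) 1 one_pos 0 (1 / 2) le_rfl (by norm_num) (by norm_num)
    (fun _ => 0) 0 measurable_const le_rfl
  refine absurd (key ?_ ?_) ?_
  · intro s hs
    exact rate_spikeVel_of_ne (ne_of_lt hs.2) one_pos
  · simp
  · intro hc
    change ell (spikeVel (1 / 2) 0) 1 * ENNReal.ofReal (Real.exp (-0)) ≤ ell (spikeVel (1 / 2) (1 / 2)) 1
      at hc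
    rw [ell_spikeVel_of_ne hτ.symm one_pos, neg_zero, Real.exp_zero, ENNReal.ofReal_one, mul_one] at hc
    exact lt_irrefl _ ((ell_spikeVel_at_lt_top (1 / 2)).trans_le hc)

/-! ## §3 Boundary: the side condition `t₂ < T` cannot be relaxed to `t₂ ≤ T` -/

/-- The crux with `t₂ < T` weakened to `t₂ ≤ T`; everything else verbatim. -/
def TautLoopLawUptoT : Prop :=
  ∀ (ν T : ℝ), 0 < ν → 0 < T → ∀ (u : ℝ → EuclideanSpace ℝ (Fin 3) → EuclideanSpace ℝ (Fin 3)) (p : ℝ → EuclideanSpace ℝ (Fin 3) → ℝ), Literature.Analysis.FluidPDE.IsClassicalNSSolutionOn (Set.Ico 0 T) ν 0 u p → Literature.Analysis.FluidPDE.IsLerayHopfOn T ν 0 (u 0) u → Literature.Analysis.FluidPDE.HasRapidSpatialDecay (u 0) → ∀ g : ℝ, 0 < g → ∀ t₁ t₂ : ℝ, 0 ≤ t₁ → t₁ ≤ t₂ → t₂ ≤ T → ∀ (Φ : ℝ → ℝ) (M : ℝ), Measurable Φ → 0 ≤ M → (∀ s ∈ Set.Ioo t₁ t₂, (⨅ ε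 : {ε : ℝ // 0 < ε}, sSup {k : ℝ | ∃ γ : ℝ → EuclideanSpace ℝ (Fin 3), Literature.Analysis.FluidPDE.IsC1Loop γ ∧ g ≤ |Literature.Analysis.FluidPDE.circulation (u s) γ| ∧ ENNReal.ofReal (∫ σ in (0:ℝ)..1, ‖deriv γ σ‖) ≤ (⨅ (γ' : ℝ → EuclideanSpace ℝ (Fin 3)) (_ : Literature.Analysis.FluidPDE.IsC1Loop γ' ∧ g ≤ |Literature.Analysis.FluidPDE.circulation (u s) γ'|), ENNReal.ofReal (∫ σ in (0:ℝ)..1, ‖deriv γ' σ‖)) + ENNReal.ofReal (ε : ℝ) ∧ k = ((∫ σ in (0:ℝ)..1, -(inner ℝ (deriv γ σ) (fderiv ℝ (u s) (γ σ) (deriv γ σ))) / ‖deriv γ σ‖) / (∫ σ in (0:ℝ)..1, ‖deriv γ σ‖))}) ≤ Φ s) → (∫⁻ s in Set.Ioo t₁ t₂, ENNReal.ofReal (Φ s)) ≤ ENNReal.ofReal M → (⨅ (γ' : ℝ → EuclideanSpace ℝ (Fin 3)) (_ : Literature.Analysis.FluidPDE.IsC1Loop γ' ∧ g ≤ |Literature.Analysis.FluidPDE.circulation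 (u t₁) γ'|), ENNReal.ofReal (∫ σ in (0:ℝ)..1, ‖deriv γ' σ‖)) * ENNReal.ofReal (Real.exp (-M)) ≤ (⨅ (γ' : ℝ → EuclideanSpace ℝ (Fin 3)) (_ : Literature.Analysis.FluidPDE.IsC1Loop γ' ∧ g ≤ |Literature.Analysis.FluidPDE.circulation (u t₂) γ'|), ENNReal.ofReal (∫ σ in (0:ℝ)..1, ‖deriv γ' σ‖))

/-- **The terminal slice is out of reach: `TautLoopLaw` with `t₂ ≤ T` is FALSE.** Witness: the rest
state on `[0, 1)` spiked on the unit sphere AT the terminal time `T = 1` is classical on `Ico 0 1`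
(the spike is outside the time set), Leray–Hopf on `[0, 1]` (a.e.-invisible spike), decaying datum
`0`; from `t₁ = 0` to `t₂ = T = 1` with `Φ = 0`, `M = 0` the law would give `⊤ ≤ ℓ(u 1, 1) < ⊤`.
The terminal slice of a Leray–Hopf solution is pinned only a.e. (weak `L²` limit), so no loop
functional of `u T` is meaningful: keep `t₂ < T` (as the deciding theorem does). -/
theorem tautLoopLaw_false_upto_terminal_time : ¬ TautLoopLawUptoT := by
  intro h
  have hτ : (1 : ℝ) ≠ 0 := one_ne_zero
  have hcl : IsClassicalNSSolutionOn (Set.Ico 0 1) 1 0 (spikeVel 1) 0 :=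
    isClassicalNSSolutionOn_spikeVel (fun h1 => (lt_irrefl (1 : ℝ)) h1.2) 1
  have key := h 1 1 one_pos one_pos (spikeVel 1) 0 hcl (isLerayHopfOn_spikeVel hτ one_pos 1)
    (hasRapidSpatialDecay_spikeVel_zero hτ) 1 one_pos 0 1 le_rfl zero_le_one le_rfl
    (fun _ => 0) 0 measurable_const le_rfl
  refine absurd (key ?_ ?_) ?_
  · intro s hs
    exact rate_spikeVel_of_ne (ne_of_lt hs.2) one_pos
  · simp
  · intro hc
    change ell (spikeVel 1 0) 1 * ENNReal.ofReal (Real.exp (-0)) ≤ ell (spikeVel 1 1) 1 at hc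
    rw [ell_spikeVel_of_ne hτ.symm one_pos, neg_zero, Real.exp_zero, ENNReal.ofReal_one, mul_one] at hc
    exact lt_irrefl _ ((ell_spikeVel_at_lt_top 1).trans_le hc)

/-! ## §4 Line `Sketch-ideas-r1k1`: sharpness of `stub_tautLoopDiniSaks` (landed as
`Theorems/TautLoopLaw/Negative/DiniSaksSharpness.lean`, p159958) — the two downward steps -/

/-- The downward step at `1`, open on the left: `2` on `(-∞, 1)`, `1` on `[1, ∞)`. -/
def stepOpen : ℝ → ℝ≥0∞ := fun s => if s < 1 then 2 else 1

/-- The downward step at `0`, closed on the left: `2` on `(-∞, 0]`, `1` on `(0, ∞)`. -/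
def stepClosed : ℝ → ℝ≥0∞ := fun s => if s ≤ 0 then 2 else 1

/-- Left of `1` the open step is `2`. -/
theorem stepOpen_of_lt {s : ℝ} (h : s < 1) : stepOpen s = 2 := by simp [stepOpen, h]

/-- From `1` on the open step is `1`. -/
theorem stepOpen_of_le {s : ℝ} (h : 1 ≤ s) : stepOpen s = 1 := by simp [stepOpen, not_lt.2 h]

/-- Up to `0` the closed step is `2`. -/
theorem stepClosed_of_le {s : ℝ} (h : s ≤ 0) : stepClosed s = 2 := by simp [stepClosed, h]

/-- Right of `0` the closed step is `1`. -/
theorem stepClosed_of_lt {s : ℝ} (h : 0 < s) : stepClosed s = 1 := by simp [stepClosed, not_le.2 h]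

/-- `1 ≤ ofReal (exp x)` for `0 ≤ x`. -/
theorem one_le_ofReal_exp {x : ℝ} (hx : 0 ≤ x) : (1 : ℝ≥0∞) ≤ ENNReal.ofReal (Real.exp x) :=
  ENNReal.one_le_ofReal.2 (Real.one_le_exp hx)

/-- A value is below itself times `ofReal (exp (h η))`, `h, η ≥ 0` (the trivial step of a locally
constant function). -/
theorem le_self_mul_ofReal_exp (x : ℝ≥0∞) {h η : ℝ} (hh : 0 ≤ h) (hη : 0 ≤ η) :
    x ≤ x * ENNReal.ofReal (Real.exp (h * (0 + η))) := by
  calc x = x * 1 := (mul_one x).symm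
    _ ≤ x * ENNReal.ofReal (Real.exp (h * (0 + η))) :=
        mul_le_mul_right (one_le_ofReal_exp (by positivity)) x

/-- **The open step is right-lower-semicontinuous at every point.** -/
theorem stepOpen_rightLsc (t : ℝ) : stepOpen t ≤ liminf stepOpen (𝓝[>] t) := by
  refine le_liminf_of_le (by isBoundedDefault) ?_
  by_cases ht : t < 1
  · filter_upwards [Ioo_mem_nhdsGT ht] with s hs
    rw [stepOpen_of_lt ht, stepOpen_of_lt hs.2]
  · filter_upwards [self_mem_nhdsWithin] with s hs
    rw [stepOpen_of_le (not_lt.1 ht), stepOpen_of_le ((not_lt.1 ht).trans (le_of_lt hs))]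

/-- **The open step satisfies the left-Dini step (rate `0`) at every time `t ≠ 1`.** -/
theorem stepOpen_step {t : ℝ} (ht : t ≠ 1) (η : ℝ) (hη : 0 < η) :
    ∀ᶠ h in 𝓝[>] (0 : ℝ), stepOpen (t - h) ≤ stepOpen t * ENNReal.ofReal (Real.exp (h * (0 + η))) := by
  rcases lt_or_gt_of_ne ht with hlt | hgt
  · filter_upwards [self_mem_nhdsWithin] with h hh
    have hh' : 0 < h := hh
    rw [stepOpen_of_lt (by linarith : t - h < 1), stepOpen_of_lt hlt]
    exact le_self_mul_ofReal_exp 2 hh'.le hη.le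
  · filter_upwards [Ioo_mem_nhdsGT (sub_pos.2 hgt)] with h hh
    rw [stepOpen_of_le (by linarith [hh.2] : 1 ≤ t - h), stepOpen_of_le hgt.le]
    exact le_self_mul_ofReal_exp 1 hh.1.le hη.le

/-- **The closed step is right-lower-semicontinuous at every `t > 0`** (and NOT at `0`). -/
theorem stepClosed_rightLsc {t : ℝ} (ht : 0 < t) : stepClosed t ≤ liminf stepClosed (𝓝[>] t) := by
  refine le_liminf_of_le (by isBoundedDefault) ?_
  filter_upwards [self_mem_nhdsWithin] with s hs
  rw [stepClosed_of_lt ht, stepClosed_of_lt (ht.trans hs)]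

/-- **The closed step satisfies the left-Dini step (rate `0`) at every time `t > 0`.** -/
theorem stepClosed_step {t : ℝ} (ht : 0 < t) (η : ℝ) (hη : 0 < η) :
    ∀ᶠ h in 𝓝[>] (0 : ℝ), stepClosed (t - h) ≤ stepClosed t * ENNReal.ofReal (Real.exp (h * (0 + η))) := by
  filter_upwards [Ioo_mem_nhdsGT ht] with h hh
  rw [stepClosed_of_lt (by linarith [hh.2] : 0 < t - h), stepClosed_of_lt ht]
  exact le_self_mul_ofReal_exp 1 hh.1.le hη.le

/-! ### Sharpness 1: no exceptional time for the left-Dini step -/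

/-- `stub_tautLoopDiniSaks` with the left-Dini step required at every `t ∈ (a, b]` EXCEPT ONE point `c`
(extra binder `c`, extra guard `t ≠ c`); everything else verbatim. -/
def DiniSaksOffOnePoint : Prop :=
  ∀ (f : ℝ → ENNReal) (Λ Φ : ℝ → ℝ) (a b M c : ℝ), a ≤ b → 0 ≤ M → Measurable Φ → (∀ s ∈ Set.Ioo a b, Λ s ≤ Φ s) → (∫⁻ s in Set.Ioo a b, ENNReal.ofReal (Φ s)) ≤ ENNReal.ofReal M → (∀ t ∈ Set.Ico a b, f t ≤ Filter.liminf f (nhdsWithin t (Set.Ioi t))) → (∀ t ∈ Set.Ioc a b, t ≠ c → ∀ η : ℝ, 0 < η → ∀ᶠ h in nhdsWithin (0:ℝ) (Set.Ioi 0), f (t - h) ≤ f t * ENNReal.ofReal (Real.exp (h * (Λ t + η)))) → f a * ENNReal.ofReal (Real.exp (-M)) ≤ f b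

/-- **One exceptional time breaks the Dini–Saks transfer.** Witness: the open downward step on
`[a, b] = [0, 2]` with the step waived at `c = 1`, `Λ = Φ = 0`, `M = 0`: all hypotheses hold and
`f 0 · 1 = 2 ≤ 1 = f 2` fails. -/
theorem diniSaks_false_off_one_point : ¬ DiniSaksOffOnePoint := by
  intro h
  have key := h stepOpen (fun _ => 0) (fun _ => 0) 0 2 0 1 (by norm_num) le_rfl measurable_const
    (fun _ _ => le_rfl) (by simp) (fun t _ => stepOpen_rightLsc t)
    (fun t _ htc η hη => stepOpen_step htc η hη)
  rw [stepOpen_of_lt (by norm_num : (0 : ℝ) < 1), stepOpen_of_le (by norm_num : (1 : ℝ) ≤ 2), neg_zero,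
    Real.exp_zero, ENNReal.ofReal_one, mul_one] at key
  exact absurd key (by norm_num)

/-! ### Sharpness 2: right-lsc is needed at the left end point itself -/

/-- `stub_tautLoopDiniSaks` with right-lower-semicontinuity required only on the OPEN interval
`(a, b)` (`Set.Ioo` for `Set.Ico`); everything else verbatim. -/
def DiniSaksLscInteriorOnly : Prop :=
  ∀ (f : ℝ → ENNReal) (Λ Φ : ℝ → ℝ) (a b M : ℝ), a ≤ b → 0 ≤ M → Measurable Φ → (∀ s ∈ Set.Ioo a b, Λ s ≤ Φ s) → (∫⁻ s in Set.Ioo a b, ENNReal.ofReal (Φ s)) ≤ ENNReal.ofReal M → (∀ t ∈ Set.Ioo a b, f t ≤ Filter.liminf f (nhdsWithin t (Set.Ioi t))) → (∀ t ∈ Set.Ioc a b, ∀ η : ℝ, 0 < η → ∀ᶠ h in nhdsWithin (0:ℝ) (Set.Ioi 0), f (t - h) ≤ f t * ENNReal.ofReal (Real.exp (h * (Λ t + η)))) → f a * ENNReal.ofReal (Real.exp (-M)) ≤ f b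

/-- **Right-lsc at the initial time is load-bearing.** Witness: the closed downward step on
`[a, b] = [0, 1]`, `Λ = Φ = 0`, `M = 0`: right-lsc on `(0, 1)`, the step everywhere on `(0, 1]`, and
`f 0 · 1 = 2 ≤ 1 = f 1` fails (the drop sits exactly at `a = 0`, seen only by right-lsc AT `a`). -/
theorem diniSaks_false_without_lsc_at_left_end : ¬ DiniSaksLscInteriorOnly := by
  intro h
  have key := h stepClosed (fun _ => 0) (fun _ => 0) 0 1 0 zero_le_one le_rfl measurable_const
    (fun _ _ => le_rfl) (by simp) (fun t ht => stepClosed_rightLsc ht.1)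
    (fun t ht η hη => stepClosed_step ht.1 η hη)
  rw [stepClosed_of_le le_rfl, stepClosed_of_lt one_pos, neg_zero, Real.exp_zero, ENNReal.ofReal_one,
    mul_one] at key
  exact absurd key (by norm_num)

/-! ## §5 Line `Sketch-ideas-r1k1`: the sup-norm right-continuity clause of
`stub_tautLoopRightLscTransfer` is load-bearing (landed as
`Theorems/TautLoopLaw/Negative/RightLscTransferSharpness.lean`, p160310) -/

/-- **The rigid rotation carries circulation `2π` on the unit circle** (its restriction to the circle is
the unit tangent; same computation as for the spike slice, which agrees with `rot` on the sphere). -/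
theorem circulation_rot_unitCircle : circulation rot unitCircle = 2 * π := by
  rw [← circulation_spikeVel_at 0]
  unfold circulation
  refine intervalIntegral.integral_congr fun σ _ => ?_
  have hn : ‖unitCircle σ‖ = 1 := by
    rw [unitCircle, circleLoop_apply, one_mul, one_mul, zero_add]
    exact norm_frame_cos_sin _
  simp only [spikeVel_at_of_norm hn]

/-- The switched-on rotation: rest for `s ≤ 0`, the rigid rotation for `s > 0`. -/
def switchOn : ℝ → ℝ³ → ℝ³ := fun s x => if s ≤ 0 then 0 else rot x

/-- Before (and at) time `0` the switched-on rotation rests. -/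
theorem switchOn_of_nonpos {s : ℝ} (hs : s ≤ 0) : switchOn s = 0 := by
  funext x; simp [switchOn, hs]

/-- After time `0` the switched-on rotation is the rigid rotation. -/
theorem switchOn_of_pos {s : ℝ} (hs : 0 < s) : switchOn s = rot := by
  funext x; simp [switchOn, not_le.2 hs]

/-- After time `0` the slices of the switched-on rotation are continuous (the rigid rotation is). -/
theorem continuous_switchOn_of_pos {s : ℝ} (hs : 0 < s) : Continuous (switchOn s) := by
  rw [switchOn_of_pos hs]
  unfold rot
  fun_prop

/-- `stub_tautLoopRightLscTransfer` with its sup-norm right-continuity clause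
`(∀ κ : ℝ, 0 < κ → ∀ᶠ s in nhdsWithin t (Set.Ioi t), ∀ x, ‖u s x - u t x‖ ≤ κ) →` DELETED; everything
else verbatim. -/
def RightLscTransferWithoutSupNorm : Prop :=
  ∀ (u : ℝ → EuclideanSpace ℝ (Fin 3) → EuclideanSpace ℝ (Fin 3)) (t g : ℝ), 0 < g → Continuous (u t) → (∀ᶠ s in nhdsWithin t (Set.Ioi t), Continuous (u s)) → ((∃ γ : ℝ → EuclideanSpace ℝ (Fin 3), Literature.Analysis.FluidPDE.IsC1Loop γ ∧ g ≤ |Literature.Analysis.FluidPDE.circulation (u t) γ|) → (⨅ (γ' : ℝ → EuclideanSpace ℝ (Fin 3)) (_ : Literature.Analysis.FluidPDE.IsC1Loop γ' ∧ g ≤ |Literature.Analysis.FluidPDE.circulation (u t) γ'|), ENNReal.ofReal (∫ σ in (0:ℝ)..1, ‖deriv γ' σ‖)) ≤ ⨆ (g' : ℝ) (_ : 0 < g' ∧ g' < g), (⨅ (γ' : ℝ → EuclideanSpace ℝ (Fin 3)) (_ : Literature.Analysis.FluidPDE.IsC1Loop γ' ∧ g' ≤ |Literature.Analysis.FluidPDE.circulation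 (u t) γ'|), ENNReal.ofReal (∫ σ in (0:ℝ)..1, ‖deriv γ' σ‖))) → (⨅ (γ' : ℝ → EuclideanSpace ℝ (Fin 3)) (_ : Literature.Analysis.FluidPDE.IsC1Loop γ' ∧ g ≤ |Literature.Analysis.FluidPDE.circulation (u t) γ'|), ENNReal.ofReal (∫ σ in (0:ℝ)..1, ‖deriv γ' σ‖)) ≤ Filter.liminf (fun s => (⨅ (γ' : ℝ → EuclideanSpace ℝ (Fin 3)) (_ : Literature.Analysis.FluidPDE.IsC1Loop γ' ∧ g ≤ |Literature.Analysis.FluidPDE.circulation (u s) γ'|), ENNReal.ofReal (∫ σ in (0:ℝ)..1, ‖deriv γ' σ‖))) (nhdsWithin t (Set.Ioi t))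

/-- **The sup-norm right-continuity clause of the transfer stub is load-bearing.** Witness: the
switched-on rotation at `t = 0`, level `g = 1`: `ℓ(u 0, 1) = ⊤` (rest slice, empty class — the
level-left-continuity premise is vacuous) but `ℓ(u s, 1) ≤ ofReal (len unitCircle) < ⊤` for all
`s > 0` (the unit circle carries `2π ≥ 1`), so the `liminf` is finite and `⊤ ≤ liminf` fails. For the
line: clause (ii) of `stub_tautLoopSlabRegularity` (sup-norm right-continuity of the classical slices,
including at `t = 0`) cannot be dropped. -/
theorem rightLscTransfer_false_without_supnorm : ¬ RightLscTransferWithoutSupNorm := by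
  intro h
  have h0 : switchOn 0 = 0 := switchOn_of_nonpos le_rfl
  have hcont : Continuous (switchOn 0) := by rw [h0]; exact continuous_const
  have hnear : ∀ᶠ s in 𝓝[>] (0 : ℝ), Continuous (switchOn s) := by
    filter_upwards [self_mem_nhdsWithin] with s hs
    exact continuous_switchOn_of_pos hs
  have hvac : (∃ γ : ℝ → ℝ³, IsC1Loop γ ∧ (1 : ℝ) ≤ |circulation (switchOn 0) γ|) →
      ell (switchOn 0) 1 ≤ ⨆ (g' : ℝ) (_ : 0 < g' ∧ g' < 1), ell (switchOn 0) g' := by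
    rintro ⟨γ, -, hγ⟩
    rw [h0, circulation_zero_left, abs_zero] at hγ
    exact absurd hγ (by norm_num)
  have key := h switchOn 0 1 one_pos hcont hnear hvac
  change ell (switchOn 0) 1 ≤ liminf (fun s => ell (switchOn s) 1) (𝓝[>] (0 : ℝ)) at key
  rw [h0, ell_zero one_pos, top_le_iff] at key
  -- the liminf is finite: eventually the slice is `rot`, whose spectrum at level 1 is finite
  have hadm : IsC1Loop unitCircle ∧ (1 : ℝ) ≤ |circulation rot unitCircle| := by
    refine ⟨isC1Loop_unitCircle, ?_⟩
    rw [circulation_rot_unitCircle, abs_of_pos (by positivity)]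
    linarith [pi_gt_three]
  have hfin : ell rot 1 < ⊤ := by
    unfold ell
    exact (iInf₂_le unitCircle hadm).trans_lt ENNReal.ofReal_lt_top
  have hev : ∀ᶠ s in 𝓝[>] (0 : ℝ), ell (switchOn s) 1 = (fun _ : ℝ => ell rot 1) s := by
    filter_upwards [self_mem_nhdsWithin] with s hs
    rw [switchOn_of_pos hs]
  have hlim : liminf (fun s => ell (switchOn s) 1) (𝓝[>] (0 : ℝ)) = ell rot 1 := by
    rw [liminf_congr hev, liminf_const]
  rw [hlim] at key
  exact absurd key hfin.ne

end Summit.NavierStokesRegularity.NavierStokesRegularity.Cruxes.TautLoopLaw.Disproof
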